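import Summits.Ventures.Crystal3D.Theorems.StickyWulffConstantCoaxialWallLawFluxGapCellTrans
import Summits.Ventures.Crystal3D.Theorems.StickyWulffConstantCoaxialWallLawFluxGap
import Summits.Ventures.Crystal3D.Theorems.StickyWulffConstantCoaxialWallLawTerracePropagation
import Summits.Ventures.Crystal3D.Theorems.StickyWulffConstantCoaxialWallLawInteriorLedger
import Summits.Ventures.Crystal3D.Theorems.StickyWulffConstantCoaxialWallLawHaggConst
import Summits.Ventures.Crystal3D.Theorems.StickyWulffConstantGenericWallFloorCoaxialIff
import Summits.Ventures.Crystal3D.Theorems.StickyWulffConstantGenericWallFloorSampleDeficitUpper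
import Summits.Ventures.Crystal3D.Theorems.StickyWulffConstantGenericWallFloorRigidRung
import Summits.Ventures.Crystal3D.Theorems.StickyWulffConstantNoReconstructionGainLatticeAdhesion
import HarnessLib

/-!
# The flux-gap rung of `stub_coaxialTwoSlabAdhesion`: general fillings, TRANSLATION pairs, modulo foreign twin dozens

HONEST FRAMING. Part of the venture `Summits/Ventures/Crystal3D` (cell `crystal3d-full`), helper
`--supports` the crux `CoaxialWallLaw` (stmt-Ventures-19481, `route-Ventures-StickyWulffConstant`),
REGISTERED line `WallLedgerF` (planner cf-p1 gen 16), open stub `stub_coaxialTwoSlabAdhesion`.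
RUNG CREDIT ONLY — this is NOT the stub: it is the stub's inequality for ARBITRARY fillings `X` of the
cell and co-axial TRANSLATION pairs (equal Hägg letters, `Λ₁ ≠ Λ₂`: two cosets of one frame), in the regime
`cos² θ = ⟪L e₃, e₃⟫² ≥ 9/25`, with the crux's constant `½` replaced by `√6/156`, with the kissing facts
`KissingGap δ` / `KissingClassification δ` taken BY NAME, and MODULO the residual `(1/26)·#FOREIGN` of
`…FluxGapTwin` (balls of `X` that are twin dozens of one of the two frames `L`, `L∘R` for a `{111}`
normal `n′ ≠ ±L e₃`).  Brick 14 (assembly, translation pairs) of the FLUX-GAP architecture (memo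
F-FLUXGAP-ARCH, evidence #7 on the crux item); companion of `coaxialTwoSlabAdhesion_general_twin_fluxGap`.

**Theorem (`coaxialTwoSlabAdhesion_general_trans_fluxGap`).**  Under the crux's co-axiality data
(`L, s₁, s₂, σ, σ'`), `A₁·Λ₀ = A₂·Λ₀`, `Λ₁ ≠ Λ₂` and `9/25 ≤ ⟪L e₃, e₃⟫²`: there are `C` and `R₀ = 10`
such that for every `h ≥ 0`, `ρ ≥ R₀`, every `1`-separated `X` in the cell with the two complete slab
samples, `cross(P₁, X∖P₁) + cross(P₂, Y) ≤ D(Y) + (φ₁ + φ₂ − (√6/156)·√(1 − ⟪L e₃, e₃⟫²)) π ρ²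
+ (1/26)·#FOREIGN + C (1 + h) ρ`.

Proof.  As for twin pairs, with the translation cell count `fluxGap_trans_payers_ge`: in the common
frame both grains are cosets of `F false ∈ {L, L∘R}` (the two Hägg letters agree);
the bottom lines leave the inner sample along the far slot `u` and can enter the top window only along
the far slot `u'` of `exists_far_slots_spread` (`√3 sin θ ≤ 2(α_u − α_{u'})`), so the gap is
`√2 (α_u − α_{u'}) π ρ² ≥ (√6/2) sin θ · π ρ² ≥ (√6/3) sin θ · π ρ²`; all three designated slots rise
because `3δ² ≤ sin²θ < 2 cos²θ` (`far_deviation_identity`).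

WHAT THIS IS NOT: not the stub (twin pairs are `…FluxGapTwin`; the regime `cos²θ < 9/25` and the
foreign-twin-dozen residual are not covered; constant `√6/156 < ½`); F-C1 not moved.
-/

noncomputable section

namespace Summit.Ventures.Crystal3D.Theorems

open Summit.Ventures.Crystal3D Finset
open Literature.MathematicalPhysics.StatisticalMechanics (fccStacking barlowStacking IsHaggSeq
  contactDeficiency)
open scoped InnerProductSpace

open scoped Classical in
/-- **The flux-gap rung of `stub_coaxialTwoSlabAdhesion` (general fillings, translation pairs,
`cos²θ ≥ 9/25`, modulo foreign twin dozens).**  See the module docstring. -/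
theorem coaxialTwoSlabAdhesion_general_trans_fluxGap {δ : ℝ} (hg : KissingGap δ) (hc : KissingClassification δ)
    (A₁ : EuclideanSpace ℝ (Fin 3) ≃ₗᵢ[ℝ] EuclideanSpace ℝ (Fin 3)) (t₁ : EuclideanSpace ℝ (Fin 3))
    (A₂ : EuclideanSpace ℝ (Fin 3) ≃ₗᵢ[ℝ] EuclideanSpace ℝ (Fin 3)) (t₂ : EuclideanSpace ℝ (Fin 3))
    (L : EuclideanSpace ℝ (Fin 3) ≃ₗᵢ[ℝ] EuclideanSpace ℝ (Fin 3)) (s₁ s₂ : EuclideanSpace ℝ (Fin 3))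
    (σ σ' : ℤ → ℤ) (hσ : IsHaggSeq σ) (hσ' : IsHaggSeq σ')
    (hsub₁ : (fun p => A₁ p + t₁) '' fccStacking 1 (Real.sqrt (2 / 3)) ⊆
      (fun p => L p + s₁) '' barlowStacking 1 (Real.sqrt (2 / 3)) σ)
    (hsub₂ : (fun p => A₂ p + t₂) '' fccStacking 1 (Real.sqrt (2 / 3)) ⊆
      (fun p => L p + s₂) '' barlowStacking 1 (Real.sqrt (2 / 3)) σ')
    (htw : σ 0 = σ' 0)
    (hne : (fun p => A₁ p + t₁) '' fccStacking 1 (Real.sqrt (2 / 3)) ≠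
      (fun p => A₂ p + t₂) '' fccStacking 1 (Real.sqrt (2 / 3)))
    (hreg : 9 / 25 ≤ ⟪L (EuclideanSpace.single (2 : Fin 3) (1 : ℝ)),
      (EuclideanSpace.single (2 : Fin 3) (1 : ℝ))⟫_ℝ ^ 2) :
    ∃ C R₀ : ℝ, 1 ≤ R₀ ∧ ∀ h : ℝ, 0 ≤ h → ∀ ρ : ℝ, R₀ ≤ ρ →
      ∀ X P₁ P₂ : Finset (EuclideanSpace ℝ (Fin 3)),
      (∀ p ∈ X, ∀ q ∈ X, p ≠ q → 1 ≤ dist p q) → P₁ ⊆ X → P₂ ⊆ X \ P₁ →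
      (∀ p ∈ X, -(2 * R₀) ≤ p 2 ∧ p 2 ≤ h + 2 * R₀ ∧ p 0 ^ 2 + p 1 ^ 2 ≤ ρ ^ 2) →
      (∀ p, p ∈ P₁ ↔ (p ∈ (fun q => A₁ q + t₁) '' fccStacking 1 (Real.sqrt (2 / 3)) ∧
        -(2 * R₀) ≤ p 2 ∧ p 2 ≤ -R₀ ∧ p 0 ^ 2 + p 1 ^ 2 ≤ ρ ^ 2)) →
      (∀ p, p ∈ P₂ ↔ (p ∈ (fun q => A₂ q + t₂) '' fccStacking 1 (Real.sqrt (2 / 3)) ∧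
        h + R₀ ≤ p 2 ∧ p 2 ≤ h + 2 * R₀ ∧ p 0 ^ 2 + p 1 ^ 2 ≤ ρ ^ 2)) →
      ((((P₁ ×ˢ (X \ P₁)).filter fun pq => dist pq.1 pq.2 = 1).card : ℕ) : ℝ) +
        ((((P₂ ×ˢ ((X \ P₁) \ P₂)).filter fun pq => dist pq.1 pq.2 = 1).card : ℕ) : ℝ) ≤
        contactDeficiency ((X \ P₁) \ P₂) +
          (Real.sqrt 2 / 4 * ∑ᶠ w ∈ {w ∈ fccStacking 1 (Real.sqrt (2 / 3)) | ‖w‖ = 1},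
              |⟪w, A₁.symm (EuclideanSpace.single (2 : Fin 3) (1 : ℝ))⟫_ℝ| +
            Real.sqrt 2 / 4 * ∑ᶠ w ∈ {w ∈ fccStacking 1 (Real.sqrt (2 / 3)) | ‖w‖ = 1},
              |⟪w, A₂.symm (EuclideanSpace.single (2 : Fin 3) (1 : ℝ))⟫_ℝ| -
            (Real.sqrt 6 / 156 : ℝ) * Real.sqrt (1 - ⟪L (EuclideanSpace.single (2 : Fin 3) (1 : ℝ)),
              (EuclideanSpace.single (2 : Fin 3) (1 : ℝ))⟫_ℝ ^ 2)) * Real.pi * ρ ^ 2 +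
          (1 / 26 : ℝ) * ((X.filter fun b =>
            ∃ G : EuclideanSpace ℝ (Fin 3) ≃ₗᵢ[ℝ] EuclideanSpace ℝ (Fin 3),
              (G = L ∨ G = (ℝ ∙ EuclideanSpace.single (2 : Fin 3) (1 : ℝ)).reflection.trans L) ∧
              ∃ n' : EuclideanSpace ℝ (Fin 3), ‖n'‖ = 1 ∧
                n' ≠ L (EuclideanSpace.single (2 : Fin 3) (1 : ℝ)) ∧
                n' ≠ -L (EuclideanSpace.single (2 : Fin 3) (1 : ℝ)) ∧
                (∀ w ∈ fccSlots, ⟪G w, n'⟫_ℝ = 0 ∨ ⟪G w, n'⟫_ℝ = Real.sqrt (2 / 3) ∨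
                  ⟪G w, n'⟫_ℝ = -Real.sqrt (2 / 3)) ∧
                (∀ w ∈ fccSlots, ⟪G w, n'⟫_ℝ ≤ 0 → b + G w ∈ X) ∧
                (∀ w ∈ fccSlots, ⟪G w, n'⟫_ℝ < 0 → b + (G w - (2 * ⟪G w, n'⟫_ℝ) • n') ∈ X) ∧
                (∀ w ∈ fccSlots, 0 < ⟪G w, n'⟫_ℝ → b + G w ∉ X)).card : ℝ) +
          C * (1 + h) * ρ := by
  set e₃ : EuclideanSpace ℝ (Fin 3) := EuclideanSpace.single (2 : Fin 3) (1 : ℝ) with he₃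
  set RL : EuclideanSpace ℝ (Fin 3) ≃ₗᵢ[ℝ] EuclideanSpace ℝ (Fin 3) :=
    (ℝ ∙ EuclideanSpace.single (2 : Fin 3) (1 : ℝ)).reflection.trans L with hRL
  have hr : 0 < Real.sqrt (2 / 3) := Real.sqrt_pos.2 (by norm_num)
  have he₃1 : ‖e₃‖ = 1 := by rw [he₃, PiLp.norm_single, norm_one]
  obtain ⟨C₁, hC₁⟩ := affineSampleDeficit_upper A₁ t₁ 10 (by norm_num)
  obtain ⟨C₂, hC₂⟩ := affineSampleDeficit_upper A₂ t₂ 10 (by norm_num)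
  -- normal form: the grains are `F false·Λ₀ + s₁`, `F false·Λ₀ + s₂` with `{F false, F true} = {L, L∘R}`
  have hnorm : ∃ F : Bool → (EuclideanSpace ℝ (Fin 3) ≃ₗᵢ[ℝ] EuclideanSpace ℝ (Fin 3)),
      ((F false = L ∧ F true = RL) ∨ (F false = RL ∧ F true = L)) ∧
      (fun q => A₁ q + t₁) '' fccStacking 1 (Real.sqrt (2 / 3)) =
        (fun q => F false q + s₁) '' fccStacking 1 (Real.sqrt (2 / 3)) ∧
      (fun q => A₂ q + t₂) '' fccStacking 1 (Real.sqrt (2 / 3)) =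
        (fun q => F false q + s₂) '' fccStacking 1 (Real.sqrt (2 / 3)) := by
    rcases hσ 0 with h1 | hm1
    · have e₁ := coaxial_frame_eq_fcc_of_one A₁ t₁ L s₁ hσ hsub₁ h1
      have e₂ := coaxial_frame_eq_fcc_of_one A₂ t₂ L s₂ hσ' hsub₂ (htw ▸ h1)
      exact ⟨fun c => cond c RL L, Or.inl ⟨rfl, rfl⟩, e₁, e₂⟩
    · obtain ⟨e₁, -⟩ := coaxial_frame_eq_fcc_of_neg_one A₁ t₁ L s₁ hσ hsub₁ hm1
      obtain ⟨e₂, -⟩ := coaxial_frame_eq_fcc_of_neg_one A₂ t₂ L s₂ hσ' hsub₂ (htw ▸ hm1)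
      exact ⟨fun c => cond c L RL, Or.inr ⟨rfl, rfl⟩, e₁, e₂⟩
  obtain ⟨F, hF, e₁, e₂⟩ := hnorm
  have hne' : (fun q => F false q + s₁) '' fccStacking 1 (Real.sqrt (2 / 3)) ≠
      (fun q => F false q + s₂) '' fccStacking 1 (Real.sqrt (2 / 3)) := by
    rw [← e₁, ← e₂]; exact hne
  -- the axis, oriented upwards: `n = ±L e₃` with `⟪n, e₃⟫ = |cos θ| ≥ 3/5`
  obtain ⟨n, hn, hcn⟩ : ∃ n : EuclideanSpace ℝ (Fin 3), (n = L e₃ ∨ n = -L e₃) ∧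
      ⟪n, e₃⟫_ℝ = |⟪L e₃, e₃⟫_ℝ| := by
    by_cases h0 : 0 ≤ ⟪L e₃, e₃⟫_ℝ
    · exact ⟨L e₃, Or.inl rfl, (abs_of_nonneg h0).symm⟩
    · refine ⟨-L e₃, Or.inr rfl, ?_⟩
      rw [inner_neg_left, abs_of_neg (lt_of_not_ge h0)]
  have hn1 : ‖n‖ = 1 := by
    rcases hn with h' | h'
    · rw [h', LinearIsometryEquiv.norm_map, he₃1]
    · rw [h', norm_neg, LinearIsometryEquiv.norm_map, he₃1]
  have hc35 : 3 / 5 ≤ ⟪n, e₃⟫_ℝ := by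
    rw [hcn, ← Real.sqrt_sq_eq_abs, show (3 / 5 : ℝ) = Real.sqrt ((3 / 5) ^ 2) by
      rw [Real.sqrt_sq (by norm_num)]]
    exact Real.sqrt_le_sqrt (by norm_num [hreg])
  have hcsq : ⟪n, e₃⟫_ℝ ^ 2 = ⟪L e₃, e₃⟫_ℝ ^ 2 := by rw [hcn, sq_abs]
  have hrc : 0 < Real.sqrt (2 / 3) * ⟪n, e₃⟫_ℝ := mul_pos hr (by linarith)
  -- menu of the frames along the axis
  have hax : ∀ c w, ⟪F c w, L e₃⟫_ℝ = w 2 := by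
    intro c w
    rcases hF with ⟨h0, h1⟩ | ⟨h0, h1⟩ <;> cases c <;> simp only [h0, h1]
    · exact inner_frame_axis L w
    · exact inner_twinFrame_axis L w
    · exact inner_twinFrame_axis L w
    · exact inner_frame_axis L w
  have hmenu0 : ∀ w ∈ fccSlots, ⟪F false w, n⟫_ℝ = 0 ∨ ⟪F false w, n⟫_ℝ = Real.sqrt (2 / 3) ∨
      ⟪F false w, n⟫_ℝ = -Real.sqrt (2 / 3) := by
    intro w hw
    have h : ⟪F false w, n⟫_ℝ = w 2 ∨ ⟪F false w, n⟫_ℝ = -w 2 := by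
      rcases hn with h' | h'
      · exact Or.inl (by rw [h', hax])
      · exact Or.inr (by rw [h', inner_neg_right, hax])
    rcases h with h | h <;> rcases slot_apply_two_cases hw with h' | h' | h' <;> rw [h, h']
    · exact Or.inl rfl
    · exact Or.inr (Or.inl rfl)
    · exact Or.inr (Or.inr rfl)
    · exact Or.inl neg_zero
    · exact Or.inr (Or.inr rfl)
    · exact Or.inr (Or.inl (neg_neg _))
  -- the far frame of the bottom grain and the spread pair `u`, `u'` of far slots
  obtain ⟨u₁, hu₁, u₂, hu₂, u₃, hu₃, hn₁, hn₂, hn₃, i12, i13, i23, -, -⟩ :=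
    exists_far_frame (F false) hn1 hmenu0
  obtain ⟨u, hu, u', hu', hS⟩ :=
    exists_far_slots_spread (F false) hn1 he₃1 hu₁ hu₂ hu₃ hn₁ hn₂ hn₃ i12 i13 i23
  have i21 : ⟪u₂, u₁⟫_ℝ = 1 / 2 := by rw [real_inner_comm]; exact i12
  have i31 : ⟪u₃, u₁⟫_ℝ = 1 / 2 := by rw [real_inner_comm]; exact i13
  have i32 : ⟪u₃, u₂⟫_ℝ = 1 / 2 := by rw [real_inner_comm]; exact i23
  have hpkg : ∀ v ∈ ({u₁, u₂, u₃} : Finset (EuclideanSpace ℝ (Fin 3))),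
      v ∈ fccSlots ∧ ⟪F false v, n⟫_ℝ = Real.sqrt (2 / 3) ∧
      3 * (⟪F false v, e₃⟫_ℝ - Real.sqrt (2 / 3) * ⟪n, e₃⟫_ℝ) ^ 2 ≤ 1 - ⟪n, e₃⟫_ℝ ^ 2 := by
    intro v hv
    simp only [mem_insert, mem_singleton] at hv
    rcases hv with rfl | rfl | rfl
    · have hid := far_deviation_identity (F false) hn1 he₃1 hu₁ hu₂ hu₃ hn₁ hn₂ hn₃ i12 i13 i23
      exact ⟨hu₁, hn₁, by linarith [hid, sq_nonneg (⟪F false u₂, e₃⟫_ℝ - ⟪F false u₃, e₃⟫_ℝ)]⟩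
    · have hid := far_deviation_identity (F false) hn1 he₃1 hu₂ hu₁ hu₃ hn₂ hn₁ hn₃ i21 i23 i13
      exact ⟨hu₂, hn₂, by linarith [hid, sq_nonneg (⟪F false u₁, e₃⟫_ℝ - ⟪F false u₃, e₃⟫_ℝ)]⟩
    · have hid := far_deviation_identity (F false) hn1 he₃1 hu₃ hu₁ hu₂ hn₃ hn₁ hn₂ i31 i32 i12
      exact ⟨hu₃, hn₃, by linarith [hid, sq_nonneg (⟪F false u₁, e₃⟫_ℝ - ⟪F false u₂, e₃⟫_ℝ)]⟩
  obtain ⟨huS, hun, h3δ⟩ := hpkg u hu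
  obtain ⟨hu'S, hun', h3δ'⟩ := hpkg u' hu'
  set dd : ℝ := ⟪F false u, e₃⟫_ℝ - Real.sqrt (2 / 3) * ⟪n, e₃⟫_ℝ with hdd
  set dd' : ℝ := ⟪F false u', e₃⟫_ℝ - Real.sqrt (2 / 3) * ⟪n, e₃⟫_ℝ with hdd'
  -- the three designated slots rise: `α_v = (F false v)₂ = √(2/3) cos θ + δ_v` (`v = u, u'`) and
  -- `(F true u)₂ = √(2/3) cos θ − δ_u`, with `3 δ_v² ≤ sin²θ < 2 cos²θ`
  have h2a : (F false u) 2 = ⟪F false u, e₃⟫_ℝ := apply_two_eq_inner_e₃ _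
  have h2a' : (F false u') 2 = ⟪F false u', e₃⟫_ℝ := apply_two_eq_inner_e₃ _
  have hn2 : n 2 = ⟪n, e₃⟫_ℝ := apply_two_eq_inner_e₃ _
  have hα₁eq : (F false u) 2 = Real.sqrt (2 / 3) * ⟪n, e₃⟫_ℝ + dd := by rw [h2a, hdd]; ring
  have hα₁eq' : (F false u') 2 = Real.sqrt (2 / 3) * ⟪n, e₃⟫_ℝ + dd' := by rw [h2a', hdd']; ring
  have key : F true u = F false (-u) - (2 * ⟪F false (-u), n⟫_ℝ) • n := by
    rcases hF with ⟨h0, h1⟩ | ⟨h0, h1⟩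
    · rw [h0, h1]
      have := twinFrame_neg_eq L hn (-u)
      rwa [neg_neg] at this
    · rw [h0, h1]
      have := frame_neg_eq L hn (-u)
      rwa [neg_neg] at this
  have hmirror : F true u = -F false u + (2 * ⟪F false u, n⟫_ℝ) • n := by
    rw [key, map_neg, inner_neg_left, mul_neg, neg_smul, sub_neg_eq_add]
  have hα₂eq : (F true u) 2 = Real.sqrt (2 / 3) * ⟪n, e₃⟫_ℝ - dd := by
    have h1 : (F true u) 2 = -(F false u) 2 + 2 * ⟪F false u, n⟫_ℝ * n 2 := by
      rw [hmirror]
      simp only [PiLp.add_apply, PiLp.neg_apply, PiLp.smul_apply, smul_eq_mul]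
    rw [h1, hun, hn2, h2a, hdd]
    ring
  have hr2 : Real.sqrt (2 / 3) ^ 2 = 2 / 3 := Real.sq_sqrt (by norm_num)
  have hc2 : 9 / 25 ≤ ⟪n, e₃⟫_ℝ ^ 2 := by rw [hcsq]; exact hreg
  have hdlt : |dd| < Real.sqrt (2 / 3) * ⟪n, e₃⟫_ℝ := by
    refine abs_lt_of_sq_lt_sq ?_ hrc.le
    rw [mul_pow, hr2]; linarith only [h3δ, hc2]
  have hdlt' : |dd'| < Real.sqrt (2 / 3) * ⟪n, e₃⟫_ℝ := by
    refine abs_lt_of_sq_lt_sq ?_ hrc.le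
    rw [mul_pow, hr2]; linarith only [h3δ', hc2]
  have hα₁pos : 0 < (F false u) 2 := by rw [hα₁eq]; linarith only [hdlt, neg_abs_le dd]
  have hα₁pos' : 0 < (F false u') 2 := by rw [hα₁eq']; linarith only [hdlt', neg_abs_le dd']
  have hα₂pos : 0 < (F true u) 2 := by rw [hα₂eq]; linarith only [hdlt, le_abs_self dd]
  have hdiff : (F false u) 2 - (F false u') 2 = dd - dd' := by rw [hα₁eq, hα₁eq']; ring
  -- the flux gap beats `(√6/3) sin θ` (even `(√6/2) sin θ`)
  have h63 : Real.sqrt 6 / 3 * Real.sqrt (1 - ⟪L e₃, e₃⟫_ℝ ^ 2) ≤ Real.sqrt 2 * (dd - dd') := by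
    have hs6 : Real.sqrt 6 = Real.sqrt 2 * Real.sqrt 3 := by
      rw [← Real.sqrt_mul (by norm_num : (0 : ℝ) ≤ 2)]; norm_num
    rw [hcsq] at hS
    have hS2 : Real.sqrt 3 * Real.sqrt (1 - ⟪L e₃, e₃⟫_ℝ ^ 2) ≤ 2 * (dd - dd') := by
      rw [hdd, hdd']; linarith only [hS]
    have hS0 : 0 ≤ Real.sqrt 3 * Real.sqrt (1 - ⟪L e₃, e₃⟫_ℝ ^ 2) := by positivity
    have h2 : 0 ≤ Real.sqrt 2 := Real.sqrt_nonneg _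
    calc Real.sqrt 6 / 3 * Real.sqrt (1 - ⟪L e₃, e₃⟫_ℝ ^ 2)
        = Real.sqrt 2 / 3 * (Real.sqrt 3 * Real.sqrt (1 - ⟪L e₃, e₃⟫_ℝ ^ 2)) := by rw [hs6]; ring
      _ ≤ Real.sqrt 2 / 2 * (Real.sqrt 3 * Real.sqrt (1 - ⟪L e₃, e₃⟫_ℝ ^ 2)) := by
          nlinarith only [hS0, h2]
      _ ≤ Real.sqrt 2 / 2 * (2 * (dd - dd')) := mul_le_mul_of_nonneg_left hS2 (by positivity)
      _ = Real.sqrt 2 * (dd - dd') := by ring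
  -- the constant
  have hCE0 : (0 : ℝ) ≤ 12 * Real.sqrt 2 * Real.pi + 2 * Real.sqrt 2 * Real.pi * ((10 - 1) / 2 + 4) +
      36 * 10 + 288 := by norm_num; positivity
  have hCK0 : (0 : ℝ) ≤ Real.sqrt 2 * Real.pi * ((10 - 1) / 2 + 4) ^ 2 / (F false u') 2 :=
    div_nonneg (by positivity) hα₁pos'.le
  refine ⟨|C₁| + |C₂| + (240 * Real.sqrt 2 * Real.pi + 3120 * (4 * 10 + 2)) / 2 +
    (12 * Real.sqrt 2 * Real.pi + 2 * Real.sqrt 2 * Real.pi * ((10 - 1) / 2 + 4) + 36 * 10 + 288) / 52 +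
    Real.sqrt 2 * Real.pi * ((10 - 1) / 2 + 4) ^ 2 / (F false u') 2 / 52, 10, by norm_num, ?_⟩
  intro h hh ρ hρ X P₁ P₂ hX hP₁X hP₂X₁ hcyl hP₁ hP₂
  set φ₁ : ℝ := Real.sqrt 2 / 4 * ∑ᶠ w ∈ {w ∈ fccStacking 1 (Real.sqrt (2 / 3)) | ‖w‖ = 1},
      |⟪w, A₁.symm e₃⟫_ℝ| with hφ₁
  set φ₂ : ℝ := Real.sqrt 2 / 4 * ∑ᶠ w ∈ {w ∈ fccStacking 1 (Real.sqrt (2 / 3)) | ‖w‖ = 1},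
      |⟪w, A₂.symm e₃⟫_ℝ| with hφ₂
  have hP₂X : P₂ ⊆ X := hP₂X₁.trans sdiff_subset
  have hρ0 : (0 : ℝ) ≤ ρ := by linarith
  -- (1) the two slab samples from above
  have hD₁ := hC₁ (-(2 * 10)) (-10) (by norm_num) ρ hρ P₁ hP₁
  have hD₂ := hC₂ (h + 10) (h + 2 * 10) (by ring) ρ hρ P₂ hP₂
  -- (2) the interior ledger
  have hled := ledger_ge_faces_add_interior A₁ t₁ A₂ t₂ X P₁ P₂ 10 h ρ le_rfl hh hρ hX hcyl hP₁X hP₂X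
    hP₁ hP₂
  have hf₁ : Real.sqrt 2 / 4 * ∑ w ∈ fccSlots, |⟪A₁ w, e₃⟫_ℝ| = φ₁ := by
    rw [hφ₁, finsum_unit_fcc_symm_eq_sum_slots]
  have hf₂ : Real.sqrt 2 / 4 * ∑ w ∈ fccSlots, |⟪A₂ w, e₃⟫_ℝ| = φ₂ := by
    rw [hφ₂, finsum_unit_fcc_symm_eq_sum_slots]
  rw [hf₁, hf₂, ← two_mul_contactDeficiency_eq_sum X] at hled
  -- (3) the payers of the interior window, fed by the flux gap
  have hP₁' := hP₁
  have hP₂' := hP₂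
  simp only [e₁, e₂] at hP₁' hP₂'
  have hpay := fluxGap_trans_payers_ge hg hc L F hF hn huS hu'S hun hun' hα₁pos hα₁pos' hα₂pos s₁ s₂
    hne' X P₁ P₂ 10 h ρ
    le_rfl hh hρ hX hcyl hP₁X hP₂X hP₁' hP₂'
  rw [hdiff] at hpay
  have hPAY : ((X.filter fun z => (X.filter fun q => dist z q = 1).card ≤ 11 ∧
        -10 - 2 ≤ z 2 ∧ z 2 ≤ h + 10 + 2).card : ℝ) ≤
      ((X.filter fun y => (X.filter fun q => dist y q = 1).card ≠ 12 ∧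
        -10 - 2 ≤ y 2 ∧ y 2 ≤ h + 10 + 2).card : ℝ) := by
    exact_mod_cast card_le_card fun z hz => by
      rw [mem_filter] at hz ⊢
      exact ⟨hz.1, by have := hz.2.1; omega, hz.2.2⟩
  -- (4) the residual in the crux's terms
  have hGF : ∀ c, F c = L ∨ F c = RL := by
    intro c
    rcases hF with ⟨h0, h1⟩ | ⟨h0, h1⟩ <;> cases c <;> simp only [h0, h1, true_or, or_true]
  have hnn : ∀ n' : EuclideanSpace ℝ (Fin 3), n' ≠ n → n' ≠ -n → n' ≠ L e₃ ∧ n' ≠ -L e₃ := by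
    intro n' h1 h2
    rcases hn with h' | h'
    · rw [h'] at h1 h2; exact ⟨h1, h2⟩
    · rw [h'] at h1 h2; rw [neg_neg] at h2; exact ⟨h2, h1⟩
  have hFOR : ((X.filter fun b => ∃ c : Bool, ∃ n' : EuclideanSpace ℝ (Fin 3), ‖n'‖ = 1 ∧ n' ≠ n ∧
        n' ≠ -n ∧
        (∀ w ∈ fccSlots, ⟪F c w, n'⟫_ℝ = 0 ∨ ⟪F c w, n'⟫_ℝ = Real.sqrt (2 / 3) ∨
          ⟪F c w, n'⟫_ℝ = -Real.sqrt (2 / 3)) ∧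
        (∀ w ∈ fccSlots, ⟪F c w, n'⟫_ℝ ≤ 0 → b + F c w ∈ X) ∧
        (∀ w ∈ fccSlots, ⟪F c w, n'⟫_ℝ < 0 → b + (F c w - (2 * ⟪F c w, n'⟫_ℝ) • n') ∈ X) ∧
        (∀ w ∈ fccSlots, 0 < ⟪F c w, n'⟫_ℝ → b + F c w ∉ X)).card : ℝ) ≤
      ((X.filter fun b => ∃ G : EuclideanSpace ℝ (Fin 3) ≃ₗᵢ[ℝ] EuclideanSpace ℝ (Fin 3),
        (G = L ∨ G = RL) ∧ ∃ n' : EuclideanSpace ℝ (Fin 3), ‖n'‖ = 1 ∧ n' ≠ L e₃ ∧ n' ≠ -L e₃ ∧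
        (∀ w ∈ fccSlots, ⟪G w, n'⟫_ℝ = 0 ∨ ⟪G w, n'⟫_ℝ = Real.sqrt (2 / 3) ∨
          ⟪G w, n'⟫_ℝ = -Real.sqrt (2 / 3)) ∧
        (∀ w ∈ fccSlots, ⟪G w, n'⟫_ℝ ≤ 0 → b + G w ∈ X) ∧
        (∀ w ∈ fccSlots, ⟪G w, n'⟫_ℝ < 0 → b + (G w - (2 * ⟪G w, n'⟫_ℝ) • n') ∈ X) ∧
        (∀ w ∈ fccSlots, 0 < ⟪G w, n'⟫_ℝ → b + G w ∉ X)).card : ℝ) := by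
    exact_mod_cast card_le_card fun b hb => by
      rw [mem_filter] at hb ⊢
      obtain ⟨hbX, c, n', h1, h2, h3, h4, h5, h6, h7⟩ := hb
      exact ⟨hbX, F c, hGF c, n', h1, (hnn n' h2 h3).1, (hnn n' h2 h3).2, h4, h5, h6, h7⟩
  -- (5) the two splits of the skeleton
  have hs₁ := contactDeficiency_sdiff_split hP₁X
  have hs₂ := contactDeficiency_sdiff_split hP₂X₁
  -- (6) assemble
  have hπρ : 0 ≤ Real.pi * ρ ^ 2 := by positivity
  have hflux : Real.sqrt 6 / 3 * Real.sqrt (1 - ⟪L e₃, e₃⟫_ℝ ^ 2) * (Real.pi * ρ ^ 2) ≤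
      Real.sqrt 2 * (dd - dd') * (Real.pi * ρ ^ 2) := mul_le_mul_of_nonneg_right h63 hπρ
  have ha : C₁ * ρ ≤ |C₁| * (1 + h) * ρ := by
    have h1 : C₁ * ρ ≤ |C₁| * ρ := mul_le_mul_of_nonneg_right (le_abs_self _) hρ0
    have h2 : 0 ≤ |C₁| * h * ρ := by positivity
    linarith only [h1, h2]
  have hb : C₂ * ρ ≤ |C₂| * (1 + h) * ρ := by
    have h1 : C₂ * ρ ≤ |C₂| * ρ := mul_le_mul_of_nonneg_right (le_abs_self _) hρ0
    have h2 : 0 ≤ |C₂| * h * ρ := by positivity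
    linarith only [h1, h2]
  have hCE : (12 * Real.sqrt 2 * Real.pi + 2 * Real.sqrt 2 * Real.pi * ((10 - 1) / 2 + 4) + 36 * 10 + 288) * ρ ≤
      (12 * Real.sqrt 2 * Real.pi + 2 * Real.sqrt 2 * Real.pi * ((10 - 1) / 2 + 4) + 36 * 10 + 288) *
        (1 + h) * ρ := by
    have := mul_nonneg (mul_nonneg hCE0 hh) hρ0
    linarith only [this]
  have h1hρ : (1 : ℝ) ≤ (1 + h) * ρ := by
    have := mul_nonneg hh hρ0
    linarith only [this, hρ]
  have hCK : Real.sqrt 2 * Real.pi * ((10 - 1) / 2 + 4) ^ 2 / (F false u') 2 ≤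
      Real.sqrt 2 * Real.pi * ((10 - 1) / 2 + 4) ^ 2 / (F false u') 2 * (1 + h) * ρ := by
    have := mul_le_mul_of_nonneg_left h1hρ hCK0
    linarith only [this]
  -- name the four counts
  set PAY : Finset (EuclideanSpace ℝ (Fin 3)) := X.filter fun z => (X.filter fun q => dist z q = 1).card ≤ 11 ∧
    -10 - 2 ≤ z 2 ∧ z 2 ≤ h + 10 + 2
  set PAY' : Finset (EuclideanSpace ℝ (Fin 3)) := X.filter fun y => (X.filter fun q => dist y q = 1).card ≠ 12 ∧
    -10 - 2 ≤ y 2 ∧ y 2 ≤ h + 10 + 2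
  set FORb : Finset (EuclideanSpace ℝ (Fin 3)) := X.filter fun b => ∃ c : Bool, ∃ n' : EuclideanSpace ℝ (Fin 3),
      ‖n'‖ = 1 ∧ n' ≠ n ∧ n' ≠ -n ∧
      (∀ w ∈ fccSlots, ⟪F c w, n'⟫_ℝ = 0 ∨ ⟪F c w, n'⟫_ℝ = Real.sqrt (2 / 3) ∨
        ⟪F c w, n'⟫_ℝ = -Real.sqrt (2 / 3)) ∧
      (∀ w ∈ fccSlots, ⟪F c w, n'⟫_ℝ ≤ 0 → b + F c w ∈ X) ∧
      (∀ w ∈ fccSlots, ⟪F c w, n'⟫_ℝ < 0 → b + (F c w - (2 * ⟪F c w, n'⟫_ℝ) • n') ∈ X) ∧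
      (∀ w ∈ fccSlots, 0 < ⟪F c w, n'⟫_ℝ → b + F c w ∉ X)
  set FORL : Finset (EuclideanSpace ℝ (Fin 3)) := X.filter fun b =>
      ∃ G : EuclideanSpace ℝ (Fin 3) ≃ₗᵢ[ℝ] EuclideanSpace ℝ (Fin 3),
      (G = L ∨ G = RL) ∧ ∃ n' : EuclideanSpace ℝ (Fin 3), ‖n'‖ = 1 ∧ n' ≠ L e₃ ∧ n' ≠ -L e₃ ∧
      (∀ w ∈ fccSlots, ⟪G w, n'⟫_ℝ = 0 ∨ ⟪G w, n'⟫_ℝ = Real.sqrt (2 / 3) ∨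
        ⟪G w, n'⟫_ℝ = -Real.sqrt (2 / 3)) ∧
      (∀ w ∈ fccSlots, ⟪G w, n'⟫_ℝ ≤ 0 → b + G w ∈ X) ∧
      (∀ w ∈ fccSlots, ⟪G w, n'⟫_ℝ < 0 → b + (G w - (2 * ⟪G w, n'⟫_ℝ) • n') ∈ X) ∧
      (∀ w ∈ fccSlots, 0 < ⟪G w, n'⟫_ℝ → b + G w ∉ X)
  have t1 : ((((P₁ ×ˢ (X \ P₁)).filter fun pq => dist pq.1 pq.2 = 1).card : ℕ) : ℝ) +
      ((((P₂ ×ˢ ((X \ P₁) \ P₂)).filter fun pq => dist pq.1 pq.2 = 1).card : ℕ) : ℝ) =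
      contactDeficiency P₁ + contactDeficiency P₂ + contactDeficiency ((X \ P₁) \ P₂) -
        contactDeficiency X := by linarith only [hs₁, hs₂]
  have t2 : Real.sqrt 6 / 3 * Real.sqrt (1 - ⟪L e₃, e₃⟫_ℝ ^ 2) * (Real.pi * ρ ^ 2) -
      (12 * Real.sqrt 2 * Real.pi + 2 * Real.sqrt 2 * Real.pi * ((10 - 1) / 2 + 4) + 36 * 10 + 288) * ρ -
      Real.sqrt 2 * Real.pi * ((10 - 1) / 2 + 4) ^ 2 / (F false u') 2 ≤
      26 * (PAY'.card : ℝ) + 2 * (FORL.card : ℝ) := by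
    linarith only [hpay, hflux, hPAY, hFOR]
  have t3 : 2 * φ₁ * Real.pi * ρ ^ 2 + 2 * φ₂ * Real.pi * ρ ^ 2 + (PAY'.card : ℝ) -
      (240 * Real.sqrt 2 * Real.pi + 3120 * (4 * 10 + 2)) * (1 + h) * ρ ≤ 2 * contactDeficiency X := by
    linarith only [hled]
  have t4 : contactDeficiency P₁ ≤ 2 * φ₁ * Real.pi * ρ ^ 2 + C₁ * ρ := hD₁
  have t5 : contactDeficiency P₂ ≤ 2 * φ₂ * Real.pi * ρ ^ 2 + C₂ * ρ := hD₂
  linarith only [t1, t2, t3, t4, t5, ha, hb, hCE, hCK]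

end Summit.Ventures.Crystal3D.Theorems

end
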